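import Summits.Ventures.PercRepro.RankLevelSetUpFiveCosimple

/-! # RankLevelSetUpFiveLongLine — (↑)₅ ON 12 ELEMENTS WHEN THE DUAL HAS SIX OR MORE COLLINEAR POINTS
(night-1 g44; dossier §56.3 in its identity form)

Let `L` be a rank-`≤ 2` set of `M✶` with `ℓ` elements, `M` of nullity `5` on `12` elements. Every bi-independent
`5`-set `W` meets `L` in `≤ 2` points and its complement spans `M✶`, so `5 ≤ 2 + #((E ∖ W) ∖ L) ≤ 2 + (9 − ℓ)`: for
`ℓ ≥ 7` there is no bi-independent `5`-set at all (**`biIndep_five_eq_empty_of_line_seven`**), and (↑)₅ is trivial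
(**`upAt_five_of_line_ge_seven`**). For `ℓ = 6` every bi-independent `6`-set `Z` meets `L` in exactly three points
(both `Z` and `E ∖ Z` span), and `Z ∖ {t}` spans only for `t ∈ Z ∩ L`: a member at level `6` has at most three
down-neighbours (**`downdeg_le_three_of_line_six`**). The up-shadow step with a down-degree bound
(**`upFam_step_down`**, the g38 step `upFam_step` with the trivial bound `k` replaced by `d`) then gives
`4·T₅ ≤ 3·T₆`, i.e. (↑)₅ at every element (**`upAt_five_of_line_six`**). Every declaration has a docstring;
imports: the cell's own modules and Mathlib only. Axioms: standard. -/

namespace PercRepro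

open Set Matroid

variable {α : Type} (M : Matroid α) [M.Finite]

/-! ## The up-shadow step with a down-degree bound -/

/-- **THE UP-SHADOW STEP WITH A DOWN-DEGREE BOUND**: if every through-`b` member `W` at level `k` has at most `c₀`
elements of `E ∖ W` in `cl W`, and every through-`b` member `W'` at level `k + 1` has at most `d` elements `t ≠ b`
with `W' ∖ {t} ∈ D_k`, then `(#E − k − c₀) · T_k ≤ d · T_{k+1}`. -/
theorem upFam_step_down {b : α} {k c₀ d : ℕ}
    (hbound : ∀ W ∈ biIndep M k, b ∈ W → {t ∈ M.E \ W | t ∈ M.closure W}.ncard ≤ c₀)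
    (hdown : ∀ W' ∈ biIndep M (k + 1), b ∈ W' → {t ∈ W' \ {b} | W' \ {t} ∈ biIndep M k}.ncard ≤ d) :
    (M.E.ncard - k - c₀) * {W ∈ biIndep M k | b ∈ W}.ncard ≤
      d * {W ∈ biIndep M (k + 1) | b ∈ W}.ncard := by
  classical
  have hAfin := through_finite M b k
  have hBfin := through_finite M b (k + 1)
  set I : Finset (Set α × Set α) := (hAfin.toFinset ×ˢ hBfin.toFinset).filter (fun p => p.1 ⊆ p.2) with hI
  -- LOWER BOUND (as in `upFam_step`)
  have hlow : (M.E.ncard - k - c₀) * hAfin.toFinset.card ≤ I.card := by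
    refine Finset.mul_card_image_le_card_of_maps_to (f := Prod.fst) ?_ _ ?_
    · intro p hp
      rw [hI, Finset.mem_filter, Finset.mem_product] at hp
      exact hp.1.1
    · intro W hW
      have hWA := hAfin.mem_toFinset.mp hW
      obtain ⟨⟨hWE, hWk, hWi, hWc⟩, hbW⟩ := hWA
      have hWfin : W.Finite := M.ground_finite.subset hWE
      set Y := M.E \ W with hY
      have hYfin : Y.Finite := M.ground_finite.subset Set.sdiff_subset
      have hYcard : Y.ncard = M.E.ncard - k := by rw [hY, Set.ncard_sdiff' hWE M.ground_finite, hWk]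
      have hcol : {t ∈ Y | t ∈ M.closure W}.ncard ≤ c₀ := hbound W ⟨hWE, hWk, hWi, hWc⟩ hbW
      have hmaps : ∀ t ∈ Y \ {t ∈ Y | t ∈ M.closure W},
          (W, insert t W) ∈ I.filter (fun p => p.1 = W) := by
        intro t ht
        have htY : t ∈ Y := ht.1
        have htcl : t ∉ M.closure W := fun h => ht.2 ⟨htY, h⟩
        rw [Finset.mem_filter, hI, Finset.mem_filter, Finset.mem_product]
        refine ⟨⟨⟨hW, ?_⟩, Set.subset_insert t W⟩, rfl⟩
        rw [hBfin.mem_toFinset]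
        refine ⟨⟨Set.insert_subset htY.1 hWE, ?_, ?_, ?_⟩, Set.mem_insert_of_mem t hbW⟩
        · rw [Set.ncard_insert_of_notMem htY.2 hWfin, hWk]
        · exact (hWi.insert_indep_iff_of_notMem htY.2).mpr ⟨htY.1, htcl⟩
        · exact hWc.subset (Set.sdiff_subset_sdiff_right (Set.subset_insert t W))
      have hinj : Set.InjOn (fun t => (W, insert t W)) (Y \ {t ∈ Y | t ∈ M.closure W}) := by
        intro t₁ ht₁ t₂ ht₂ heq
        have h : insert t₁ W = insert t₂ W := congrArg Prod.snd heq
        have : t₁ ∈ insert t₂ W := h ▸ Set.mem_insert t₁ W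
        rcases this with h' | h'
        · exact h'
        · exact absurd h' ht₁.1.2
      have hcard1 : (Y \ {t ∈ Y | t ∈ M.closure W}).ncard = Y.ncard - {t ∈ Y | t ∈ M.closure W}.ncard :=
        Set.ncard_sdiff (fun t ht => ht.1) (hYfin.subset (fun t ht => ht.1))
      calc M.E.ncard - k - c₀ ≤ (Y \ {t ∈ Y | t ∈ M.closure W}).ncard := by
            rw [hcard1, hYcard]; omega
        _ = ((fun t => (W, insert t W)) '' (Y \ {t ∈ Y | t ∈ M.closure W})).ncard :=
            hinj.ncard_image.symm
        _ ≤ (I.filter (fun p => p.1 = W)).card := by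
            rw [← Set.ncard_coe_finset]
            refine Set.ncard_le_ncard ?_ (Finset.finite_toSet _)
            rintro p ⟨t, ht, rfl⟩
            exact hmaps t ht
  -- UPPER BOUND: the preimages of `W'` inject into its down-neighbours
  have hup : I.card ≤ d * hBfin.toFinset.card := by
    refine Finset.card_le_mul_card_image_of_maps_to (f := Prod.snd) ?_ _ ?_
    · intro p hp
      rw [hI, Finset.mem_filter, Finset.mem_product] at hp
      exact hp.1.2
    · intro W' hW'
      have hW'B := hBfin.mem_toFinset.mp hW'
      have hW'fin : W'.Finite := M.ground_finite.subset hW'B.1.1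
      have hex : ∀ p ∈ I.filter (fun p => p.2 = W'), ∃ t ∈ W' \ {b}, p.1 = W' \ {t} := by
        intro p hp
        rw [Finset.mem_filter, hI, Finset.mem_filter, Finset.mem_product] at hp
        obtain ⟨⟨⟨hpA, -⟩, hsub⟩, hp2⟩ := hp
        rw [hp2] at hsub
        have hpA' := hAfin.mem_toFinset.mp hpA
        have h1 : (W' \ p.1).ncard = 1 := by
          rw [Set.ncard_sdiff hsub (M.ground_finite.subset hpA'.1.1), hW'B.1.2.1, hpA'.1.2.1]; omega
        obtain ⟨t, ht⟩ := Set.ncard_eq_one.mp h1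
        have htW' : t ∈ W' \ p.1 := by rw [ht]; exact Set.mem_singleton t
        refine ⟨t, ⟨htW'.1, fun hb => htW'.2 (by rw [Set.mem_singleton_iff] at hb; rw [hb]; exact hpA'.2)⟩, ?_⟩
        ext x
        constructor
        · intro hx
          exact ⟨hsub hx, fun h => htW'.2 (by rw [Set.mem_singleton_iff] at h; rw [← h]; exact hx)⟩
        · intro hx
          by_contra hxp
          have : x ∈ W' \ p.1 := ⟨hx.1, hxp⟩
          rw [ht, Set.mem_singleton_iff] at this
          exact hx.2 (by rw [this]; exact Set.mem_singleton t)
      choose g hg using hex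
      set g' : Set α × Set α → α := fun p => if h : p ∈ I.filter (fun p => p.2 = W') then g p h else b with hg'
      have hg'eq : ∀ p (hp : p ∈ I.filter (fun p => p.2 = W')), g' p = g p hp := by
        intro p hp
        simp only [hg', dif_pos hp]
      set D := {t ∈ W' \ {b} | W' \ {t} ∈ biIndep M k} with hD
      have hDfin : D.Finite := (hW'fin.subset Set.sdiff_subset).subset (fun t ht => ht.1)
      calc (I.filter (fun p => p.2 = W')).card ≤ hDfin.toFinset.card := by
            refine Finset.card_le_card_of_injOn g' ?_ ?_
            · intro p hp
              rw [Finset.mem_coe] at hp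
              rw [Finset.mem_coe, hDfin.mem_toFinset, hg'eq p hp]
              refine ⟨(hg p hp).1, ?_⟩
              rw [← (hg p hp).2]
              have hp' := Finset.mem_filter.mp hp
              have hpI := hp'.1
              rw [hI, Finset.mem_filter, Finset.mem_product] at hpI
              exact (hAfin.mem_toFinset.mp hpI.1.1).1
            · intro p hp q hq heq
              rw [Finset.mem_coe] at hp hq
              rw [hg'eq p hp, hg'eq q hq] at heq
              have hp' := Finset.mem_filter.mp hp
              have hq' := Finset.mem_filter.mp hq
              refine Prod.ext ?_ (hp'.2.trans hq'.2.symm)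
              rw [(hg p hp).2, (hg q hq).2, heq]
        _ ≤ d := by
          rw [← Set.ncard_eq_toFinset_card _ hDfin]
          exact hdown W' hW'B.1 hW'B.2
  rw [Set.ncard_eq_toFinset_card _ hAfin, Set.ncard_eq_toFinset_card _ hBfin]
  exact hlow.trans hup

/-! ## Rank bounds along a line of the dual -/

/-- **The rank of a set is at most the rank of its part on `L` plus the size of the rest.** -/
lemma eRk_le_two_add_encard_sdiff {N : Matroid α} {L X : Set α} (hL : N.eRk L ≤ 2) :
    N.eRk X ≤ 2 + (X \ L).encard := by
  have h1 : X = (X ∩ L) ∪ (X \ L) := (Set.inter_union_sdiff X L).symm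
  calc N.eRk X = N.eRk ((X ∩ L) ∪ (X \ L)) := by rw [← h1]
    _ ≤ N.eRk (X ∩ L) + N.eRk (X \ L) := N.eRk_union_le_eRk_add_eRk _ _
    _ ≤ 2 + (X \ L).encard := by
        gcongr
        · exact (N.eRk_mono Set.inter_subset_right).trans hL
        · exact N.eRk_le_encard _

/-- **A bi-independent `5`-set meets a rank-`≤ 2` set of the dual in at most two points, and its complement has at
most `9 − ℓ` points off the line** (`M` of nullity `5` on `12` elements, `L ⊆ E` with `ℓ` elements). -/
lemma line_counts_of_mem_biIndep_five (hν : M✶.eRank = 5) (hn : M.E.ncard = 12) {L : Set α} (hLE : L ⊆ M.E)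
    (hL : M✶.eRk L ≤ 2) {W : Set α} (hW : W ∈ biIndep M 5) :
    (W ∩ L).ncard ≤ 2 ∧ 5 ≤ 2 + ((M.E \ W) \ L).ncard ∧
      ((M.E \ W) \ L).ncard + (W \ L).ncard = 12 - L.ncard := by
  have hWB : M✶.IsBase W := isBase_dual_of_mem_biIndep_five M hν hW
  have hWfin : W.Finite := M.ground_finite.subset hW.1
  have hLfin : L.Finite := M.ground_finite.subset hLE
  refine ⟨?_, ?_, ?_⟩
  · have h := (hWB.indep.subset Set.inter_subset_left).encard_le_eRk_of_subset (Set.inter_subset_right) |>.trans hL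
    rw [(hWfin.subset Set.inter_subset_left).encard_eq_coe_toFinset_card,
      ← Set.ncard_eq_toFinset_card _ (hWfin.subset Set.inter_subset_left)] at h
    exact_mod_cast h
  · have hsp : M✶.Spanning (M.E \ W) := dual_spanning_compl_of_indep M hW.2.2.1
    have h5 : M✶.eRk (M.E \ W) = 5 := by rw [hsp.eRk_eq, hν]
    have h := eRk_le_two_add_encard_sdiff (X := M.E \ W) hL
    rw [h5] at h
    have hfin : ((M.E \ W) \ L).Finite := M.ground_finite.subset (fun x hx => hx.1.1)
    rw [hfin.encard_eq_coe_toFinset_card, ← Set.ncard_eq_toFinset_card _ hfin] at h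
    exact_mod_cast h
  · have h1 : ((M.E \ W) \ L) ∪ (W \ L) = M.E \ L := by
      ext x
      simp only [Set.mem_union, Set.mem_sdiff]
      constructor
      · rintro (⟨⟨hxE, -⟩, hxL⟩ | ⟨hxW, hxL⟩)
        · exact ⟨hxE, hxL⟩
        · exact ⟨hW.1 hxW, hxL⟩
      · rintro ⟨hxE, hxL⟩
        by_cases hxW : x ∈ W
        · exact Or.inr ⟨hxW, hxL⟩
        · exact Or.inl ⟨⟨hxE, hxW⟩, hxL⟩
    have hdj : Disjoint ((M.E \ W) \ L) (W \ L) := by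
      rw [Set.disjoint_left]; exact fun x hx hx' => hx.1.2 hx'.1
    have h2 := Set.ncard_union_eq hdj (M.ground_finite.subset (fun x hx => hx.1.1)) (hWfin.subset Set.sdiff_subset)
    rw [h1, Set.ncard_sdiff' hLE M.ground_finite, hn] at h2
    exact h2.symm

/-- **Seven collinear points in the dual leave no bi-independent `5`-set.** -/
lemma biIndep_five_eq_empty_of_line_seven (hν : M✶.eRank = 5) (hn : M.E.ncard = 12) {L : Set α}
    (hLE : L ⊆ M.E) (hL : M✶.eRk L ≤ 2) (hL7 : 7 ≤ L.ncard) : biIndep M 5 = ∅ := by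
  rw [Set.eq_empty_iff_forall_notMem]
  intro W hW
  obtain ⟨h2, h5, hsum⟩ := line_counts_of_mem_biIndep_five M hν hn hLE hL hW
  have hWfin : W.Finite := M.ground_finite.subset hW.1
  have hWL : (W \ L).ncard + (W ∩ L).ncard = 5 := by
    have := Set.ncard_inter_add_ncard_sdiff_eq_ncard W L hWfin
    rw [hW.2.1] at this; omega
  omega

/-- **(↑)₅ is trivial when the dual has seven collinear points.** -/
theorem upAt_five_of_line_ge_seven (hν : M✶.eRank = 5) (hn : M.E.ncard = 12) {L : Set α} (hLE : L ⊆ M.E)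
    (hL : M✶.eRk L ≤ 2) (hL7 : 7 ≤ L.ncard) (b : α) : BiIndepUpAt M b 5 := by
  unfold BiIndepUpAt
  rw [biIndep_five_eq_empty_of_line_seven M hν hn hLE hL hL7]
  simp

/-- **A bi-independent `6`-set meets a six-point line of the dual in exactly three points, and the three points off
the line are coloops of `M✶|Z`**: for `t ∈ Z ∖ L`, `Z ∖ {t}` is not bi-independent at level `5`. -/
lemma downdeg_le_three_of_line_six (hν : M✶.eRank = 5) (hn : M.E.ncard = 12) {L : Set α} (hLE : L ⊆ M.E)
    (hL : M✶.eRk L ≤ 2) (hL6 : L.ncard = 6) {b : α} {Z : Set α} (hZ : Z ∈ biIndep M 6) :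
    {t ∈ Z \ {b} | Z \ {t} ∈ biIndep M 5}.ncard ≤ 3 := by
  have hZfin : Z.Finite := M.ground_finite.subset hZ.1
  have hLfin : L.Finite := M.ground_finite.subset hLE
  -- `Z` spans the dual: `5 ≤ 2 + #(Z ∖ L)`
  have hZsp : M✶.Spanning Z := dual_spanning_of_mem_biIndep M hZ
  have hZ5 : M✶.eRk Z = 5 := by rw [hZsp.eRk_eq, hν]
  have hZL : 5 ≤ 2 + (Z \ L).ncard := by
    have h := eRk_le_two_add_encard_sdiff (X := Z) hL
    rw [hZ5, (hZfin.subset Set.sdiff_subset).encard_eq_coe_toFinset_card,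
      ← Set.ncard_eq_toFinset_card _ (hZfin.subset Set.sdiff_subset)] at h
    exact_mod_cast h
  -- `E ∖ Z` spans the dual: `5 ≤ 2 + #((E ∖ Z) ∖ L)`
  have hcsp : M✶.Spanning (M.E \ Z) := dual_spanning_compl_of_indep M hZ.2.2.1
  have hc5 : M✶.eRk (M.E \ Z) = 5 := by rw [hcsp.eRk_eq, hν]
  have hcfin : ((M.E \ Z) \ L).Finite := M.ground_finite.subset (fun x hx => hx.1.1)
  have hcL : 5 ≤ 2 + ((M.E \ Z) \ L).ncard := by
    have h := eRk_le_two_add_encard_sdiff (X := M.E \ Z) hL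
    rw [hc5, hcfin.encard_eq_coe_toFinset_card, ← Set.ncard_eq_toFinset_card _ hcfin] at h
    exact_mod_cast h
  -- the two parts off the line partition `E ∖ L` (six elements)
  have hpart : ((M.E \ Z) \ L).ncard + (Z \ L).ncard = 6 := by
    have h1 : ((M.E \ Z) \ L) ∪ (Z \ L) = M.E \ L := by
      ext x
      simp only [Set.mem_union, Set.mem_sdiff]
      constructor
      · rintro (⟨⟨hxE, -⟩, hxL⟩ | ⟨hxZ, hxL⟩)
        · exact ⟨hxE, hxL⟩
        · exact ⟨hZ.1 hxZ, hxL⟩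
      · rintro ⟨hxE, hxL⟩
        by_cases hxZ : x ∈ Z
        · exact Or.inr ⟨hxZ, hxL⟩
        · exact Or.inl ⟨⟨hxE, hxZ⟩, hxL⟩
    have hdj : Disjoint ((M.E \ Z) \ L) (Z \ L) := by
      rw [Set.disjoint_left]; exact fun x hx hx' => hx.1.2 hx'.1
    have h2 := Set.ncard_union_eq hdj hcfin (hZfin.subset Set.sdiff_subset)
    rw [h1, Set.ncard_sdiff' hLE M.ground_finite, hn, hL6] at h2
    exact h2.symm
  have hZL3 : (Z \ L).ncard = 3 := by omega
  -- `#(Z ∩ L) = 3`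
  have hZint : (Z ∩ L).ncard = 3 := by
    have := Set.ncard_inter_add_ncard_sdiff_eq_ncard Z L hZfin
    rw [hZ.2.1, hZL3] at this; omega
  -- a down-neighbour lies on the line
  have hsub : {t ∈ Z \ {b} | Z \ {t} ∈ biIndep M 5} ⊆ Z ∩ L := by
    rintro t ⟨htZ, ht5⟩
    refine ⟨htZ.1, ?_⟩
    by_contra htL
    -- `Z ∖ {t}` spans the dual, but has only two points off the line
    have hsp' : M✶.Spanning (Z \ {t}) := dual_spanning_of_mem_biIndep M ht5
    have h5' : M✶.eRk (Z \ {t}) = 5 := by rw [hsp'.eRk_eq, hν]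
    have hfin' : ((Z \ {t}) \ L).Finite := hZfin.subset (fun x hx => hx.1.1)
    have h := eRk_le_two_add_encard_sdiff (X := Z \ {t}) hL
    rw [h5', hfin'.encard_eq_coe_toFinset_card, ← Set.ncard_eq_toFinset_card _ hfin'] at h
    have h' : 5 ≤ 2 + ((Z \ {t}) \ L).ncard := by exact_mod_cast h
    have heq : (Z \ {t}) \ L = (Z \ L) \ {t} := by
      ext x; simp only [Set.mem_sdiff, Set.mem_singleton_iff]; tauto
    have htZL : t ∈ Z \ L := ⟨htZ.1, htL⟩
    rw [heq, Set.ncard_sdiff_singleton_of_mem htZL, hZL3] at h'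
    omega
  exact (Set.ncard_le_ncard hsub (hZfin.subset Set.inter_subset_left)).trans hZint.le

/-- **(↑)₅ AT EVERY ELEMENT WHEN THE DUAL HAS SIX COLLINEAR POINTS** (night-1 g44, §56.3): `M` coloop-free without
a series triple, of nullity `5` on `12` elements, `L ⊆ E` of rank `≤ 2` in `M✶` with six elements. Then
`4·T₅ ≤ 3·T₆` by the up-shadow step (every through-`b` complement has `≤ 3` coloops, every member at level `6` has
`≤ 3` down-neighbours), hence `BiIndepUpAt M b 5`. -/
theorem upAt_five_of_line_six (hcol : ∀ e, ¬ M.IsColoop e) (hnt : NoSeriesTriple M) (hν : M✶.eRank = 5)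
    (hn : M.E.ncard = 12) {L : Set α} (hLE : L ⊆ M.E) (hL : M✶.eRk L ≤ 2) (hL6 : L.ncard = 6) {b : α}
    (hb : b ∈ M.E) : BiIndepUpAt M b 5 := by
  rw [upAt_iff_through_le_through M hb (by omega), hn]
  have hstep := upFam_step_down M (b := b) (k := 5) (c₀ := 3) (d := 3)
    (fun W hW _ => coloops_le_three M hcol hnt hν.le hn.ge hW)
    (fun Z hZ _ => downdeg_le_three_of_line_six M hν hn hLE hL hL6 hZ)
  rw [hn] at hstep
  have e : 12 - 1 - 5 = 5 + 1 := by norm_num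
  rw [e]
  omega

end PercRepro
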